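import Mathlib
import HarnessLib
import HarnessLib.Audit
import Summits.Langlands.Langlands.Theses.ParahoricFibre
import Summits.Langlands.Langlands.Theses.MonodromyRankLadder
import Literature.NumberTheory.GaloisRepresentations.WeilDeligneRepFrobSemisimpleProofs
import Literature.NumberTheory.GaloisRepresentations.WeilDeligneOfGaloisExistence
import Literature.NumberTheory.GaloisRepresentations.WeilDeligneOfGaloisProofs
import Literature.NumberTheory.GaloisRepresentations.GrothendieckDeligneWeilDeligneExistenceHolds

/-!
# MonodromyRankLadder — lens-3 node (decomp-langlands, lens-3 gen 18) on the small-range residual of `ParahoricFibre`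

TARGET `T` = `Summit.Langlands.Langlands.Theses.ParahoricFibre.SmallRangeGenericMonodromy` (stmt-Langlands-18195,
crux r4 OPEN, the DECLARED RESIDUAL of route-Langlands-ParahoricFibre: for K CM, π regular algebraic cuspidal on
GL_n(𝔸_K), every p, ι and every semisimple Satake-compatible ρ, OFF the patching range, the Weil–Deligne
representation W = WD(ρ|Γ_{K_v}) at every v ∤ p is GENERIC in the sense of Allen 2016 Def. 1.1.2 —
`Hom_WD(W, W(1)) = 0`, written inline).

THE ONE EQUIV (lens-3 translation, nilpotent-orbit RANK language).  Let W′ be the Frobenius-semisimplification of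
W (same space, same N, semisimple Weil action r = W′.ρ; tree `WeilDeligneRep.IsFrobSemisimplificationOf`,
existence PROVED `WeilDeligneRep.exists_isFrobSemisimplificationOf`).  The monodromy operators compatible with r
are the N″ of the Weil–Deligne representations W″ with W″.ρ = r (Vogan's space P(r) = Hom_{W}(r, r(−1))).  Then
    W generic  ⟺  W′ generic  ⟺  ∀ k ≥ 1, ∀ W″ with W″.ρ = W′.ρ:  rk (W″.N)ᵏ ≤ rk (W′.N)ᵏ      («RANK-MAXIMAL»)
(first step: `FrobSemisimplificationGeneric` — Hom_WD(W,W(1)) is the fixed space of the unipotent part of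
Frobenius acting on Hom_WD(W′,W′(1)), and a unipotent operator on a non-zero space fixes a non-zero vector;
second step: `GenericIffRankMaximal` — the generic N form the unique open G(r)-orbit of P(r) (Vogan 1993
Prop. 4.5, A'Campo 2024 Lemma 3.1.9, A'Campo–Hevesi–Thorne–Whitmore 2026 Prop. 6.0.5 — tree
`WeilDeligneRep.AHTW2026_prop_6_0_5_generic_conj`, DISCHARGED), every N″ ∈ P(r) lies in its closure so its
interval ranks are dominated (AHTW Prop. 6.0.5 (3): (r,N″) ≺ (r,N_gen); Bellaïche–Chenevier §7.8 / tree
`WeilDeligneRep.PrecI.finrank_range_pow_le`), and P(r)-orbits are CLASSIFIED by the ranks of the interval maps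
of the equioriented type-A quiver (Abeasis–Del Fra–Kraft 1981), so equality of all total ranks forces the generic
orbit).  Both dictionary facts are typed below as support statements (PROVABLE NOW; algebra only).

THE SPLIT BENEATH (by nilpotency depth k — a conjunct split of the translated conclusion, no population dial):
* X₁ `ConductorRung`   (crux 2): k = 1 — the rank of the monodromy of W′ is MAXIMAL on its Weil action.  In Taylor
  normal form this is exactly the CONDUCTOR / EULER-FACTOR EQUALITY a(ρ|Γ_v) = a(π_v), L(s, ρ|Γ_v ⊗ χ) =
  L(s, π_v ⊗ χ) (all max-rank monodromies on r have the same multiset of segment ends): the part of local–global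
  compatibility at v ∤ p visible to L- and ε-factors of GL₁-twists.  For n ≤ 3 it is all of T.
* X₂ `DepthRungs`      (crux 3, declared residual): k ≥ 2 GIVEN k = 1 — among the max-rank monodromies on r, W′.N has
  the maximal ranks of all powers.  Load-bearing only where P(r) has two max-rank orbits (the generic multisegment
  of r has a strictly interior nested pair — n ≥ 4, e.g. π_v = St₃(χ) × χν); invisible to every local factor of a
  character twist.  PROVED here for n ≤ 3 (`depthRungs_rank_le_three`, linear algebra of nilpotents in dimension
  ≤ 3) — the BC5 witness.
KERNEL (0 sorry): `closes : ConductorRung → DepthRungs → GenericIffRankMaximal → FrobSemisimplificationGeneric → T`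
(W from the PROVED Grothendieck–Deligne dictionary `GrothendieckDeligne_exists_isWeilDeligneOfLadic_holds`, W′ from
`exists_isFrobSemisimplificationOf`); EXACTNESS `target_iff_pieces (hJ hG) : T ↔ ConductorRung ∧ DepthRungs`
(necessity through the PROVED uniqueness `IsWeilDeligneOfLadic.isEquivalent_holds` and a transport of the generic clause along the isomorphism);
(the necessity certificates `target_of_genericMonodromy : GenericMonodromy → T` / `pieces_of_genericMonodromy` live only in the
KIT node, not in this twin — crit-1 row 285 d1: no modulo-cycle through the shared item 10863); `root_of_rungs : pieces → host items → Langlands` through `ParahoricFibre.closes`.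

CENSUS TWIN (census-1 g25, landing of the lens's `…MonodromyRankLadder.twin.lean`, crit-1 row 285 d1 landing file): the route is BORN
(78th cell route, route-Langlands-MonodromyRankLadder rev 0 @91cb73c0f8c1, items X₁ 27781 · X₂ 27782 · J · G · Assembly 27785 (closed by
`Theorems/MonodromyRankLadderAssembly.lean`)), so the five statements X₁, X₂, J, G, Assembly are NOT re-declared here: every kernel below refers to the
BORN ROUTE DECLS BY NAME (`open Summit.Langlands.Langlands.Theses.MonodromyRankLadder (…)`); the BC5/t3 witness `depthRungs_rank_le_three` and its
s-case `TargetRankLeThree` are tree declarations after this landing (`--supports stmt-Langlands-18195 --as helper`).  Nothing here proves `Langlands`,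
OCC, or T.
-/

set_option linter.dupNamespace false -- project-wide option (lakefile weak.linter.dupNamespace); `Summit.Langlands.Langlands` is the mandated namespace

namespace Summit.Langlands.Langlands.Theorems.MonodromyRank

open Summit.Langlands.Langlands.Theses.MonodromyRankLadder (ConductorRung DepthRungs GenericIffRankMaximal
  FrobSemisimplificationGeneric Assembly)

open Summit.Langlands.Langlands.Theses.ParahoricFibre (SmallRangeGenericMonodromy
  ParahoricOccurrence OccurrenceToGeneric MonodromyToLanglands)






open scoped NumberField
open IsDedekindDomain Module Literature.NumberTheory.GaloisRepresentations

/-! ## A transport lemma (genericity clause along an isomorphism; cf. `WeilDeligneRep.IsGeneric.of_equiv`) -/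

/-- The inline generic clause `Hom(r, r(1))^{N} = 0` transports along a pair of mutually inverse
intertwiners `a : V → V₀`, `b : V₀ → V` (plain linear algebra; stated over bare linear maps so that it
does not depend on the `WeilDeligneGeneric` module). -/
theorem genericClause_transport {C : Type*} [Field C] {V V₀ : Type*} [AddCommGroup V] [Module C V]
    [AddCommGroup V₀] [Module C V₀] {G : Type*} (ρ : G → V →ₗ[C] V) (ρ₀ : G → V₀ →ₗ[C] V₀)
    (N : V →ₗ[C] V) (N₀ : V₀ →ₗ[C] V₀) (c : G → C) (a : V →ₗ[C] V₀) (b : V₀ →ₗ[C] V)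
    (hba : ∀ v, b (a v) = v) (ha : ∀ w v, a (ρ w v) = ρ₀ w (a v)) (hb : ∀ w v, b (ρ₀ w v) = ρ w (b v))
    (haN : ∀ v, a (N v) = N₀ (a v)) (hbN : ∀ v, b (N₀ v) = N (b v))
    (h₀ : ∀ g : V₀ →ₗ[C] V₀, (∀ w, g ∘ₗ ρ₀ w = c w • (ρ₀ w ∘ₗ g)) → g ∘ₗ N₀ = N₀ ∘ₗ g → g = 0) :
    ∀ f : V →ₗ[C] V, (∀ w, f ∘ₗ ρ w = c w • (ρ w ∘ₗ f)) → f ∘ₗ N = N ∘ₗ f → f = 0 := by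
  intro f hf hN
  have hf' : ∀ w v, f (ρ w v) = c w • ρ w (f v) := fun w v => by
    simpa using LinearMap.congr_fun (hf w) v
  have hN' : ∀ v, f (N v) = N (f v) := fun v => by simpa using LinearMap.congr_fun hN v
  have hg : a ∘ₗ f ∘ₗ b = 0 := by
    refine h₀ (a ∘ₗ f ∘ₗ b) (fun w => ?_) ?_
    · ext v
      simp only [LinearMap.coe_comp, Function.comp_apply, LinearMap.smul_apply]
      rw [hb, hf', map_smul, ha]
    · ext v
      simp only [LinearMap.coe_comp, Function.comp_apply]
      rw [hbN, hN', haN]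
  ext v
  have h1 := LinearMap.congr_fun hg (a v)
  simp only [LinearMap.coe_comp, Function.comp_apply, LinearMap.zero_apply, hba] at h1
  have h2 := congrArg b h1
  simpa [hba] using h2

/-! ## Kernel -/

open IsDedekindDomain NumberField Polynomial Filter Literature.NumberTheory.Automorphic Literature.NumberTheory.GaloisRepresentations in
/-- From the two rungs: W′.N is rank-maximal for EVERY power k ≥ 1 (k = 1 is X₁, k ≥ 2 is X₂ fed with X₁). -/
theorem rankMaximal_of_rungs (h₁ : ConductorRung) (h₂ : DepthRungs)
    (K : Type) [Field K] [NumberField K] (hK : NumberField.IsCMField K) (n : ℕ)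
    (hcpt : Literature.NumberTheory.Automorphic.isCompact_glFiniteIntegralLevel n K)
    (π : Literature.NumberTheory.Automorphic.CuspidalAutomorphicRepData n K hcpt) (hπ : π.1.IsRegularAlgebraic)
    (p : ℕ) [Fact p.Prime] (ι : PadicAlgCl p ≃+* ℂ) (ρ : FramedGaloisRep K (PadicAlgCl p) n)
    (hss : ρ.toGaloisRep.IsSemisimple)
    (hSat : ∀ᶠ v : HeightOneSpectrum (𝓞 K) in Filter.cofinite, ∀ α : Multiset ℂ, π.1.HasSatakeParamAt v α →
      ρ.IsUnramifiedAt v ∧ ρ.HasFrobCharpolyAt v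
        (Literature.NumberTheory.Automorphic.arithFrobPolyOfSatake ι v.residueCard n α))
    (hoff : ¬ (n ^ 2 < p ∧ ¬ ((p : ℤ) ∣ NumberField.discr K) ∧ (∀ w : HeightOneSpectrum (𝓞 K), ((p : ℕ) : 𝓞 K) ∈ w.asIdeal → π.1.IsUnramifiedAt w) ∧ (∃ g : GL (Fin n) (PadicAlgCl p), (∀ (σ : Field.absoluteGaloisGroup K) (i j : Fin n), ‖((g * ρ σ * g⁻¹ : GL (Fin n) (PadicAlgCl p)) : Matrix (Fin n) (Fin n) (PadicAlgCl p)) i j‖ ≤ 1) ∧ (∀ M : Matrix (Fin n) (Fin n) ℤ, M.det = 1 → ∃ σ : Field.absoluteGaloisGroup K, ∀ i j : Fin n, ‖((g * ρ σ * g⁻¹ : GL (Fin n) (PadicAlgCl p)) : Matrix (Fin n) (Fin n) (PadicAlgCl p)) i j - ((M i j : ℤ) : PadicAlgCl p)‖ < 1)) ∧ (∃ l : ℕ, l.Prime ∧ l ≠ p ∧ ∀ w : HeightOneSpectrum (𝓞 K), ((l : ℕ) : 𝓞 K) ∈ w.asIdeal → w.residueCard = l ∧ ρ.IsUnramifiedAt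 w ∧ ∃ a : Fin n → PadicAlgCl p, ρ.HasFrobCharpolyAt w (∏ i, (X - C (a i))) ∧ ∀ i j : Fin n, i ≠ j → ‖a i - a j‖ = 1 ∧ ‖a i - (l : PadicAlgCl p) * a j‖ = 1))) (v : HeightOneSpectrum (𝓞 K)) (hv : ((p : ℕ) : 𝓞 K) ∉ v.asIdeal)
    (W : WeilDeligneRep (v.adicCompletion K) (PadicAlgCl p) (Fin n → PadicAlgCl p))
    (hW : IsWeilDeligneOfLadic (ρ.toLocal v).toWeilGroupHom W)
    (W' : WeilDeligneRep (v.adicCompletion K) (PadicAlgCl p) (Fin n → PadicAlgCl p))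
    (hW' : W'.IsFrobSemisimplificationOf W)
    (W'' : WeilDeligneRep (v.adicCompletion K) (PadicAlgCl p) (Fin n → PadicAlgCl p)) (hρ : W''.ρ = W'.ρ)
    (k : ℕ) (hk : 1 ≤ k) :
    finrank (PadicAlgCl p) (LinearMap.range (W''.N ^ k)) ≤ finrank (PadicAlgCl p) (LinearMap.range (W'.N ^ k)) := by
  have hmax1 : ∀ W'' : WeilDeligneRep (v.adicCompletion K) (PadicAlgCl p) (Fin n → PadicAlgCl p), W''.ρ = W'.ρ →
      finrank (PadicAlgCl p) (LinearMap.range W''.N) ≤ finrank (PadicAlgCl p) (LinearMap.range W'.N) :=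
    h₁ K hK n hcpt π hπ p ι ρ hss hSat hoff v hv W hW W' hW'
  rcases Nat.lt_or_ge k 2 with hlt | hge
  · obtain rfl : k = 1 := by omega
    rw [pow_one, pow_one]
    exact hmax1 W'' hρ
  · exact h₂ K hK n hcpt π hπ p ι ρ hss hSat hoff v hv W hW W' hW' hmax1 W'' hρ k hge

/-- DECIDING THEOREM of the node: the two rungs and the two dictionary facts give T BY NAME.  W is supplied by the
PROVED Grothendieck–Deligne dictionary, W′ by the PROVED existence of the Frobenius-semisimplification; J turns
rank-maximality into genericity of W′, G carries it back to W; the generic clause of T is `IsGeneric` unfolded. -/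
theorem target_of_rungs (h₁ : ConductorRung) (h₂ : DepthRungs) (hJ : GenericIffRankMaximal)
    (hG : FrobSemisimplificationGeneric) : SmallRangeGenericMonodromy := by
  intro K _ _ hK n hcpt π hπ p _ ι ρ hss hSat hoff v hv
  obtain ⟨W, hW⟩ := GrothendieckDeligne_exists_isWeilDeligneOfLadic.toLocal
    GrothendieckDeligne_exists_isWeilDeligneOfLadic_holds K n p ρ v hv
  obtain ⟨W', hW'⟩ := WeilDeligneRep.exists_isFrobSemisimplificationOf W
  have hmax := rankMaximal_of_rungs h₁ h₂ K hK n hcpt π hπ p ι ρ hss hSat hoff v hv W hW W' hW'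
  have hgen' := (hJ (v.adicCompletion K) (PadicAlgCl p) (Fin n → PadicAlgCl p) W' hW'.isFrobSemisimple).mpr
    (fun W'' hρ k hk => hmax W'' hρ k hk)
  have hgen := (hG (v.adicCompletion K) (PadicAlgCl p) (Fin n → PadicAlgCl p) W W' hW').mpr hgen'
  exact ⟨W, hW, hgen⟩

/-! ## Exactness: every piece is implied by T (mod the dictionary), and T ⟺ X₁ ∧ X₂ -/

open IsDedekindDomain NumberField Polynomial Filter Literature.NumberTheory.Automorphic Literature.NumberTheory.GaloisRepresentations in
/-- Necessity: T ⇒ X₁ ∧ X₂ (mod J, G).  Given W, W′ and T's generic W₀: W ≃ W₀ (PROVED uniqueness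
`IsWeilDeligneOfLadic.isEquivalent_holds`), so W is generic (`IsEquivalent.isGeneric_iff`), so W′ is (G), so W′.N is
rank-maximal for every k ≥ 1 (J): k = 1 is X₁'s conclusion, k ≥ 2 is X₂'s. -/
theorem pieces_of_target (hJ : GenericIffRankMaximal) (hG : FrobSemisimplificationGeneric)
    (hT : SmallRangeGenericMonodromy) : ConductorRung ∧ DepthRungs := by
  have key : ∀ (K : Type) [Field K] [NumberField K], NumberField.IsCMField K → ∀ (n : ℕ)
      (hcpt : Literature.NumberTheory.Automorphic.isCompact_glFiniteIntegralLevel n K)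
      (π : Literature.NumberTheory.Automorphic.CuspidalAutomorphicRepData n K hcpt), π.1.IsRegularAlgebraic →
      ∀ (p : ℕ) [Fact p.Prime] (ι : PadicAlgCl p ≃+* ℂ) (ρ : FramedGaloisRep K (PadicAlgCl p) n),
      ρ.toGaloisRep.IsSemisimple →
      (∀ᶠ v : HeightOneSpectrum (𝓞 K) in Filter.cofinite, ∀ α : Multiset ℂ, π.1.HasSatakeParamAt v α →
        ρ.IsUnramifiedAt v ∧ ρ.HasFrobCharpolyAt v
          (Literature.NumberTheory.Automorphic.arithFrobPolyOfSatake ι v.residueCard n α)) →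
      ¬ (n ^ 2 < p ∧ ¬ ((p : ℤ) ∣ NumberField.discr K) ∧ (∀ w : HeightOneSpectrum (𝓞 K), ((p : ℕ) : 𝓞 K) ∈ w.asIdeal → π.1.IsUnramifiedAt w) ∧ (∃ g : GL (Fin n) (PadicAlgCl p), (∀ (σ : Field.absoluteGaloisGroup K) (i j : Fin n), ‖((g * ρ σ * g⁻¹ : GL (Fin n) (PadicAlgCl p)) : Matrix (Fin n) (Fin n) (PadicAlgCl p)) i j‖ ≤ 1) ∧ (∀ M : Matrix (Fin n) (Fin n) ℤ, M.det = 1 → ∃ σ : Field.absoluteGaloisGroup K, ∀ i j : Fin n, ‖((g * ρ σ * g⁻¹ : GL (Fin n) (PadicAlgCl p)) : Matrix (Fin n) (Fin n) (PadicAlgCl p)) i j - ((M i j : ℤ) : PadicAlgCl p)‖ < 1)) ∧ (∃ l : ℕ, l.Prime ∧ l ≠ p ∧ ∀ w : HeightOneSpectrum (𝓞 K), ((l : ℕ) : 𝓞 K) ∈ w.asIdeal → w.residueCard = l ∧ ρ.IsUnramifiedAt w ∧ ∃ a : Fin n → PadicAlgCl p, ρ.HasFrobCharpolyAt w (∏ i,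 (X - C (a i))) ∧ ∀ i j : Fin n, i ≠ j → ‖a i - a j‖ = 1 ∧ ‖a i - (l : PadicAlgCl p) * a j‖ = 1)) → ∀ (v : HeightOneSpectrum (𝓞 K)), ((p : ℕ) : 𝓞 K) ∉ v.asIdeal →
      ∀ (W : WeilDeligneRep (v.adicCompletion K) (PadicAlgCl p) (Fin n → PadicAlgCl p)),
      IsWeilDeligneOfLadic (ρ.toLocal v).toWeilGroupHom W →
      ∀ (W' : WeilDeligneRep (v.adicCompletion K) (PadicAlgCl p) (Fin n → PadicAlgCl p)),
      W'.IsFrobSemisimplificationOf W →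
      ∀ (W'' : WeilDeligneRep (v.adicCompletion K) (PadicAlgCl p) (Fin n → PadicAlgCl p)), W''.ρ = W'.ρ →
      ∀ k : ℕ, 1 ≤ k →
        finrank (PadicAlgCl p) (LinearMap.range (W''.N ^ k)) ≤ finrank (PadicAlgCl p) (LinearMap.range (W'.N ^ k)) := by
    intro K _ _ hK n hcpt π hπ p _ ι ρ hss hSat hoff v hv W hW W' hW' W'' hρ k hk
    obtain ⟨W₀, hW₀, hgen₀⟩ := hT K hK n hcpt π hπ p ι ρ hss hSat hoff v hv
    have heq : W.IsEquivalent W₀ := IsWeilDeligneOfLadic.isEquivalent_holds _ W W₀ hW hW₀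
    obtain ⟨e⟩ := heq
    -- transport T's generic clause from W₀ to W along e (uniqueness of the Grothendieck–Deligne class)
    have hgW : ∀ f : (Fin n → PadicAlgCl p) →ₗ[PadicAlgCl p] (Fin n → PadicAlgCl p),
        (∀ w : WeilGroup (v.adicCompletion K), f ∘ₗ W.ρ w =
          ((IsNonarchimedeanLocalField.residueFieldCard (v.adicCompletion K) : PadicAlgCl p) ^ (WeilGroup.deg w)) •
            (W.ρ w ∘ₗ f)) → f ∘ₗ W.N = W.N ∘ₗ f → f = 0 :=
      genericClause_transport (fun w => W.ρ w) (fun w => W₀.ρ w) W.N W₀.N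
        (fun w => ((IsNonarchimedeanLocalField.residueFieldCard (v.adicCompletion K) : PadicAlgCl p) ^ (WeilGroup.deg w)))
        e.toLinearMap e.symm.toLinearMap
        (fun x => by
          change e.toLinearEquiv.symm (e.toLinearEquiv x) = x
          exact e.toLinearEquiv.symm_apply_apply x)
        (fun w x => by simpa using LinearMap.congr_fun (e.isIntertwining' w) x)
        (fun w x => by simpa using LinearMap.congr_fun (e.symm.isIntertwining' w) x)
        (fun x => by simpa using LinearMap.congr_fun e.comm_N x)
        (fun x => by simpa using LinearMap.congr_fun e.symm.comm_N x)
        hgen₀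
    have hgW' := (hG (v.adicCompletion K) (PadicAlgCl p) (Fin n → PadicAlgCl p) W W' hW').mp hgW
    exact (hJ (v.adicCompletion K) (PadicAlgCl p) (Fin n → PadicAlgCl p) W' hW'.isFrobSemisimple).mp hgW' W'' hρ k hk
  refine ⟨?_, ?_⟩
  · intro K _ _ hK n hcpt π hπ p _ ι ρ hss hSat hoff v hv W hW W' hW' W'' hρ
    have h1 := key K hK n hcpt π hπ p ι ρ hss hSat hoff v hv W hW W' hW' W'' hρ 1 le_rfl
    rw [pow_one, pow_one] at h1
    exact h1
  · intro K _ _ hK n hcpt π hπ p _ ι ρ hss hSat hoff v hv W hW W' hW' _ W'' hρ k hk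
    exact key K hK n hcpt π hπ p ι ρ hss hSat hoff v hv W hW W' hW' W'' hρ k (by omega)

/-- THE ONE EQUIV of the node (lens-3), certified in kernel modulo the two dictionary supports:
T ⟺ ConductorRung ∧ DepthRungs. -/
theorem target_iff_pieces (hJ : GenericIffRankMaximal) (hG : FrobSemisimplificationGeneric) :
    SmallRangeGenericMonodromy ↔ (ConductorRung ∧ DepthRungs) :=
  ⟨pieces_of_target hJ hG, fun h => target_of_rungs h.1 h.2 hJ hG⟩

/-! ## BC5 rung (witness of weakness for the residual X₂): `DepthRungs` restricted to `n ≤ 3` is a THEOREM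
(pure linear algebra of nilpotent operators in dimension ≤ 3), while T restricted to `n ≤ 3`
(`TargetRankLeThree`, the tribunal `--s-case`) contains the open Allen–Newton residual (n = 2 off the patching range). -/

section LinAlg

open Module LinearMap

variable {C V : Type*} [Field C] [AddCommGroup V] [Module C V] [FiniteDimensional C V]

/-- A nilpotent endomorphism of a finite-dimensional vector space vanishes to the power `finrank`. -/
theorem pow_finrank_eq_zero_of_isNilpotent {T : Module.End C V} (hT : IsNilpotent T) :
    T ^ (finrank C V) = 0 := by
  have h := (LinearMap.isNilpotent_iff_charpoly T).mp hT
  have h2 := T.aeval_self_charpoly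
  rw [h] at h2
  simpa using h2

omit [FiniteDimensional C V] in
/-- A submodule stable under `T` (with `p.map T = p`) is stable under every power: `p.map (T ^ j) = p`. -/
theorem map_pow_eq_of_map_eq {T : Module.End C V} {p : Submodule C V} (h : p.map T = p) (j : ℕ) :
    p.map (T ^ j) = p := by
  induction j with
  | zero => simp [Module.End.one_eq_id]
  | succ j ih => rw [pow_succ, Module.End.mul_eq_comp, Submodule.map_comp, h, ih]

/-- Strict decrease of ranks along powers of a non-zero nilpotent endomorphism. -/
theorem finrank_range_mul_self_lt {T : Module.End C V} (hT : IsNilpotent T) (hT0 : T ≠ 0) :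
    finrank C (range (T * T)) < finrank C (range T) := by
  by_contra h
  rw [not_lt] at h
  have hle : range (T * T) ≤ range T := by
    rw [Module.End.mul_eq_comp]; exact LinearMap.range_comp_le_range T T
  have heq : range (T * T) = range T := Submodule.eq_of_le_of_finrank_le hle h
  have hmap : (range T).map T = range T := by
    rw [← LinearMap.range_comp, ← Module.End.mul_eq_comp]; exact heq
  have key := map_pow_eq_of_map_eq hmap (finrank C V)
  rw [pow_finrank_eq_zero_of_isNilpotent hT, Submodule.map_zero] at key
  exact hT0 (LinearMap.range_eq_bot.mp key.symm)

/-- `rk T ≤ rk T² + dim ker T` (rank–nullity for `T` restricted to its range). -/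
theorem finrank_range_le_finrank_range_mul_self_add (T : Module.End C V) :
    finrank C (range T) ≤ finrank C (range (T * T)) + finrank C (ker T) := by
  have hrn := LinearMap.finrank_range_add_finrank_ker (T.domRestrict (range T))
  have h1 : range (T.domRestrict (range T)) = range (T * T) := by
    rw [LinearMap.range_domRestrict, Module.End.mul_eq_comp, LinearMap.range_comp]
  have h2 : finrank C (ker (T.domRestrict (range T))) ≤ finrank C (ker T) := by
    rw [LinearMap.ker_domRestrict]
    calc finrank C (Submodule.comap (range T).subtype (ker T))
        = finrank C ((Submodule.comap (range T).subtype (ker T)).map (range T).subtype) :=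
          (Submodule.finrank_map_subtype_eq _ _).symm
      _ ≤ finrank C (ker T) := Submodule.finrank_mono (Submodule.map_comap_le _ _)
  rw [h1] at hrn
  omega

/-- In dimension ≤ 3, rank-dominance of nilpotents propagates to all powers `k ≥ 2`. -/
theorem finrank_range_pow_le_of_finrank_le_three {M N : Module.End C V} (hV : finrank C V ≤ 3)
    (hM : IsNilpotent M)
    (h1 : finrank C (range M) ≤ finrank C (range N)) (k : ℕ) (hk : 2 ≤ k) :
    finrank C (range (M ^ k)) ≤ finrank C (range (N ^ k)) := by
  by_cases hVk : finrank C V ≤ k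
  · have hMk : M ^ k = 0 := pow_eq_zero_of_le hVk (pow_finrank_eq_zero_of_isNilpotent hM)
    rw [hMk, LinearMap.range_zero, finrank_bot]
    exact Nat.zero_le _
  · obtain rfl : k = 2 := by omega
    have hV3 : finrank C V = 3 := by omega
    by_cases hM0 : M = 0
    · rw [hM0, zero_pow two_ne_zero, LinearMap.range_zero, finrank_bot]
      exact Nat.zero_le _
    · have hlt := finrank_range_mul_self_lt hM hM0
      have hN2 := finrank_range_le_finrank_range_mul_self_add N
      have hrn := LinearMap.finrank_range_add_finrank_ker N
      rw [hV3] at hrn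
      rw [pow_two, pow_two]
      omega

end LinAlg

open IsDedekindDomain NumberField Polynomial Filter Literature.NumberTheory.Automorphic Literature.NumberTheory.GaloisRepresentations in
/-- BC5 RUNG (proved, no sorry): X₂ = `DepthRungs` holds for every `n ≤ 3` — in dimension ≤ 3 rank-dominance of nilpotent
monodromies propagates to all powers (`finrank_range_pow_le_of_finrank_le_three`).  Outside S's known regime: T for n = 2, 3 off the
patching range is open (Allen–Newton 2020 §1; Matsumoto 2023 Thm 1.5 needs the range). -/
theorem depthRungs_rank_le_three :
    ∀ (K : Type) [Field K] [NumberField K], NumberField.IsCMField K → ∀ (n : ℕ) (hcpt : isCompact_glFiniteIntegralLevel n K) (π : CuspidalAutomorphicRepData n K hcpt), π.1.IsRegularAlgebraic → ∀ (p : ℕ) [Fact p.Prime] (ι : PadicAlgCl p ≃+* ℂ) (ρ : FramedGaloisRep K (PadicAlgCl p) n), ρ.toGaloisRep.IsSemisimple → (∀ᶠ v : HeightOneSpectrum (𝓞 K) in cofinite, ∀ α : Multiset ℂ, π.1.HasSatakeParamAt v α → ρ.IsUnramifiedAt v ∧ ρ.HasFrobCharpolyAt v (arithFrobPolyOfSatake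 ι v.residueCard n α)) → ¬ (n ^ 2 < p ∧ ¬ ((p : ℤ) ∣ NumberField.discr K) ∧ (∀ w : HeightOneSpectrum (𝓞 K), ((p : ℕ) : 𝓞 K) ∈ w.asIdeal → π.1.IsUnramifiedAt w) ∧ (∃ g : GL (Fin n) (PadicAlgCl p), (∀ (σ : Field.absoluteGaloisGroup K) (i j : Fin n), ‖((g * ρ σ * g⁻¹ : GL (Fin n) (PadicAlgCl p)) : Matrix (Fin n) (Fin n) (PadicAlgCl p)) i j‖ ≤ 1) ∧ (∀ M : Matrix (Fin n) (Fin n) ℤ, M.det = 1 → ∃ σ : Field.absoluteGaloisGroup K, ∀ i j : Fin n, ‖((g * ρ σ * g⁻¹ : GL (Fin n) (PadicAlgCl p)) : Matrix (Fin n) (Fin n) (PadicAlgCl p)) i j - ((M i j : ℤ) : PadicAlgCl p)‖ < 1)) ∧ (∃ l : ℕ, l.Prime ∧ l ≠ p ∧ ∀ w : HeightOneSpectrum (𝓞 K), ((l : ℕ) : 𝓞 K) ∈ w.asIdeal → w.residueCard = l ∧ ρ.IsUnramifiedAt w ∧ ∃ a : Fin n → PadicAlgCl p, ρ.HasFrobCharpolyAt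 w (∏ i, (X - C (a i))) ∧ ∀ i j : Fin n, i ≠ j → ‖a i - a j‖ = 1 ∧ ‖a i - (l : PadicAlgCl p) * a j‖ = 1)) → ∀ v : HeightOneSpectrum (𝓞 K), ((p : ℕ) : 𝓞 K) ∉ v.asIdeal → n ≤ 3 → ∀ W : WeilDeligneRep (v.adicCompletion K) (PadicAlgCl p) (Fin n → PadicAlgCl p), IsWeilDeligneOfLadic (ρ.toLocal v).toWeilGroupHom W → ∀ W' : WeilDeligneRep (v.adicCompletion K) (PadicAlgCl p) (Fin n → PadicAlgCl p), W'.IsFrobSemisimplificationOf W → (∀ W'' : WeilDeligneRep (v.adicCompletion K) (PadicAlgCl p) (Fin n → PadicAlgCl p), W''.ρ = W'.ρ → Module.finrank (PadicAlgCl p) (LinearMap.range W''.N) ≤ Module.finrank (PadicAlgCl p) (LinearMap.range W'.N)) → ∀ W'' : WeilDeligneRep (v.adicCompletion K) (PadicAlgCl p) (Fin n → PadicAlgCl p), W''.ρ = W'.ρ → ∀ k : ℕ, 2 ≤ k → Module.finrank (PadicAlgCl p) (LinearMap.range (W''.N ^ k)) ≤ Module.finrank (PadicAlgCl p) (LinearMap.range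 (W'.N ^ k)) := by
  intro K _ _ hK n hcpt π hπ p _ ι ρ hss hSat hoff v hv hn W hW W' hW' hmax1 W'' hρ k hk
  have hV : Module.finrank (PadicAlgCl p) (Fin n → PadicAlgCl p) ≤ 3 := by
    rw [Module.finrank_fin_fun]; exact hn
  exact finrank_range_pow_le_of_finrank_le_three hV W''.isNilpotent_N (hmax1 W'' hρ) k hk

open IsDedekindDomain NumberField Polynomial Filter Literature.NumberTheory.Automorphic Literature.NumberTheory.GaloisRepresentations in
/-- The S-restricted case matching the rung (tribunal `--s-case`): T for `n ≤ 3`.  NOT provable in the tree (open). -/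
def TargetRankLeThree : Prop :=
  ∀ (K : Type) [Field K] [NumberField K], NumberField.IsCMField K → ∀ (n : ℕ) (hcpt : isCompact_glFiniteIntegralLevel n K) (π : CuspidalAutomorphicRepData n K hcpt), π.1.IsRegularAlgebraic → ∀ (p : ℕ) [Fact p.Prime] (ι : PadicAlgCl p ≃+* ℂ) (ρ : FramedGaloisRep K (PadicAlgCl p) n), ρ.toGaloisRep.IsSemisimple → (∀ᶠ v : HeightOneSpectrum (𝓞 K) in cofinite, ∀ α : Multiset ℂ, π.1.HasSatakeParamAt v α → ρ.IsUnramifiedAt v ∧ ρ.HasFrobCharpolyAt v (arithFrobPolyOfSatake ι v.residueCard n α)) → ¬ (n ^ 2 < p ∧ ¬ ((p : ℤ) ∣ NumberField.discr K) ∧ (∀ w : HeightOneSpectrum (𝓞 K), ((p : ℕ) : 𝓞 K) ∈ w.asIdeal → π.1.IsUnramifiedAt w) ∧ (∃ g : GL (Fin n) (PadicAlgCl p), (∀ (σ : Field.absoluteGaloisGroup K) (i j : Fin n), ‖((g * ρ σ * g⁻¹ : GL (Fin n) (PadicAlgCl p)) : Matrix (Fin n) (Fin n) (PadicAlgCl p))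 i j‖ ≤ 1) ∧ (∀ M : Matrix (Fin n) (Fin n) ℤ, M.det = 1 → ∃ σ : Field.absoluteGaloisGroup K, ∀ i j : Fin n, ‖((g * ρ σ * g⁻¹ : GL (Fin n) (PadicAlgCl p)) : Matrix (Fin n) (Fin n) (PadicAlgCl p)) i j - ((M i j : ℤ) : PadicAlgCl p)‖ < 1)) ∧ (∃ l : ℕ, l.Prime ∧ l ≠ p ∧ ∀ w : HeightOneSpectrum (𝓞 K), ((l : ℕ) : 𝓞 K) ∈ w.asIdeal → w.residueCard = l ∧ ρ.IsUnramifiedAt w ∧ ∃ a : Fin n → PadicAlgCl p, ρ.HasFrobCharpolyAt w (∏ i, (X - C (a i))) ∧ ∀ i j : Fin n, i ≠ j → ‖a i - a j‖ = 1 ∧ ‖a i - (l : PadicAlgCl p) * a j‖ = 1)) → ∀ v : HeightOneSpectrum (𝓞 K), ((p : ℕ) : 𝓞 K) ∉ v.asIdeal → n ≤ 3 → ∃ W : WeilDeligneRep (v.adicCompletion K) (PadicAlgCl p) (Fin n → PadicAlgCl p), IsWeilDeligneOfLadic (ρ.toLocal v).toWeilGroupHom W ∧ ∀ f : (Fin n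 → PadicAlgCl p) →ₗ[PadicAlgCl p] (Fin n → PadicAlgCl p), (∀ w : WeilGroup (v.adicCompletion K), f ∘ₗ W.ρ w = ((IsNonarchimedeanLocalField.residueFieldCard (v.adicCompletion K) : PadicAlgCl p) ^ (WeilGroup.deg w)) • (W.ρ w ∘ₗ f)) → f ∘ₗ W.N = W.N ∘ₗ f → f = 0

/-- `TargetRankLeThree` is literally T restricted to `n ≤ 3`. -/
theorem targetRankLeThree_of_target (hT : SmallRangeGenericMonodromy) : TargetRankLeThree := by
  intro K _ _ hK n hcpt π hπ p _ ι ρ hss hSat hoff v hv _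
  exact hT K hK n hcpt π hπ p ι ρ hss hSat hoff v hv

/-- Chain to the summit constant through the host's deciding theorem `ParahoricFibre.closes`
(host items by name: ParahoricOccurrence 18194, OccurrenceToGeneric 18196, MonodromyToLanglands 10829, Assembly 18197). -/
theorem root_of_rungs (h₁ : ConductorRung) (h₂ : DepthRungs) (hJ : GenericIffRankMaximal)
    (hG : FrobSemisimplificationGeneric) (hOcc : ParahoricOccurrence) (hOG : OccurrenceToGeneric)
    (hM : MonodromyToLanglands) (hA : Summit.Langlands.Langlands.Theses.ParahoricFibre.Assembly) :
    _root_.Langlands :=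
  Summit.Langlands.Langlands.Theses.ParahoricFibre.closes hOcc hOG (target_of_rungs h₁ h₂ hJ hG) hM hA

end Summit.Langlands.Langlands.Theorems.MonodromyRank
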